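import Summits.NavierStokesRegularity.NavierStokesRegularity.Theorems.ExtremiserTransienceBackwardConeTools
import Summits.NavierStokesRegularity.NavierStokesRegularity.Theorems.SqueezeCycleExtremalElementExistsRescale
import HarnessLib

/-!
# Backward-cone propagation of scale-invariant levels — the one-point estimate

Helper file for rung R8 `ScrewSymmetricLiouville` of LINE g9-β `filament_selection` on crux
stmt-NavierStokesRegularity-26567 (`NearExtremalTransiencePerFlow`). SYMMETRY-FREE. This file: the
shrinking zone and the one-point estimate of the localised Kato bootstrap; the bootstrap itself and
the theorem below are in `ExtremiserTransienceBackwardConePropagation.lean`.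

**Theorem** (`exists_backwardCone_violator`). There is a universal `ε₁ > 0` such that for every
level `0 < ε ≤ ε₁` and every Type-I constant `C` there is a radius `ρ = ρ(ε, C)` with: for every
`u ∈ A_C` (`IsTypeIAncientMild C u`), every `t₀ < 0` and `x₀` with `√(−t₀)‖u(t₀, x₀)‖ > ε`
there is `x'` with `‖x' − x₀‖ ≤ ρ√(−t₀)` and `√(−36 t₀)‖u(36 t₀, x')‖ > ε`.

So violators of scale-invariant smallness propagate BACKWARD in time inside parabolic cones
WITHOUT LOSS OF LEVEL: the sup norm does not increase under the heat flow while the Type-I weight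
`√(−t)` gains the factor `6` from `36 t₀` to `t₀`, which pays for the localisation errors.

Proof (`backwardCone_normalised`, after the Navier–Stokes zoom to `t₀ = −1`, `x₀ = 0`): if
`‖v(−36, y)‖ ≤ ε/6` on `‖y‖ ≤ ρ`, `ρ = 6K + 1`, a localised Kato bootstrap on the shrinking zone
`Z = {(τ, y) : −36 ≤ τ ≤ −1, ‖y‖ ≤ ρ − K√(τ + 36)}` gives `‖v‖ ≤ 2a` on `Z`, `a = ε/6 + O(C/K) +
O(C²/√K)`: the mild formula from `s = −36` (`mild_eq_heatExtension`), the caloric term by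
`norm_heatExtension_le_of_small_on_ball` (distance `≥ K√(τ+36)` to the large data), the Duhamel
term split along `Z ⊔ Zᶜ` (`oseenDuhamel_eq_add_of_indicator_compl_spaceTime`): near part
`≤ 12 C_B M²` (`exists_norm_oseenDuhamel_bounded_le`, `M` = running sup on the zone), far part
`≤ 12 C₁ C² (K/6)^{-1/2}` (`exists_norm_oseenDuhamel_far_le`; points outside the zone at time `τ`
are at distance `≥ (K/12)(t − τ)` from the zone at time `t`, `zone_gap`). The running sup never
enters `(2a, 1/(2 C_B'))` and starts below; a first bad point is excluded by continuity in time at a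
fixed space point (the zone shrinks, so earlier slices contain it).
[cite: KochNadirashviliSereginSverak2009, §3 (3.8), §4 p. 8 (arXiv:0709.3599)]
-/

noncomputable section

set_option linter.dupNamespace false

open Set Function Filter MeasureTheory Metric
open scoped Topology ENNReal

namespace Summit.NavierStokesRegularity.NavierStokesRegularity.Theorems.ScrewSymmetricLiouville

open Literature.Analysis Literature.Analysis.FluidPDE Literature.Analysis.UnboundedOperators
open Summit.NavierStokesRegularity.NavierStokesRegularity.Theorems

/-! ### The shrinking zone -/

/-- **Gap of the shrinking zone**: for `−36 ≤ τ ≤ t ≤ −1`,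
`K√(t+36) − K√(τ+36) ≥ (K/12)(t − τ)` (`√(t+36) + √(τ+36) ≤ 12`). [folklore] -/
theorem zone_gap {K τ t : ℝ} (hK : 0 ≤ K) (h36 : -36 ≤ τ) (hτt : τ ≤ t) (ht : t ≤ -1) :
    K / 12 * (t - τ) ≤ K * Real.sqrt (t + 36) - K * Real.sqrt (τ + 36) := by
  have ha : 0 ≤ τ + 36 := by linarith
  have hb : 0 ≤ t + 36 := by linarith
  have hsa := Real.mul_self_sqrt ha
  have hsb := Real.mul_self_sqrt hb
  have hle : Real.sqrt (τ + 36) ≤ Real.sqrt (t + 36) := Real.sqrt_le_sqrt (by linarith)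
  have h6 : Real.sqrt (t + 36) ≤ 6 := by
    rw [show (6 : ℝ) = Real.sqrt (6 ^ 2) by rw [Real.sqrt_sq (by norm_num)]]
    exact Real.sqrt_le_sqrt (by linarith)
  have key : t - τ ≤ (Real.sqrt (t + 36) - Real.sqrt (τ + 36)) * 12 := by
    have h1 : (Real.sqrt (t + 36) - Real.sqrt (τ + 36)) * (Real.sqrt (t + 36) + Real.sqrt (τ + 36)) =
        t - τ := by nlinarith [hsa, hsb]
    have h2 : Real.sqrt (t + 36) + Real.sqrt (τ + 36) ≤ 12 := by linarith [Real.sqrt_nonneg (τ + 36)]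
    nlinarith [sub_nonneg.2 hle, h1, h2, Real.sqrt_nonneg (τ + 36)]
  nlinarith [key, hK]

/-- `(t + 36)^{1/4} ≤ 3` for `t ≤ −1` (`35 ≤ 81 = 3⁴`). [folklore] -/
theorem rpow_quarter_le_three {t : ℝ} (h36 : -36 < t) (ht : t ≤ -1) :
    (t + 36) ^ (1 / 4 : ℝ) ≤ 3 := by
  have h1 : (t + 36) ^ (1 / 4 : ℝ) ≤ (81 : ℝ) ^ (1 / 4 : ℝ) :=
    Real.rpow_le_rpow (by linarith) (by linarith) (by norm_num)
  have h2 : (81 : ℝ) ^ (1 / 4 : ℝ) = 3 := by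
    rw [show (81 : ℝ) = 3 ^ (4 : ℝ) by norm_num, ← Real.rpow_mul (by norm_num)]
    norm_num
  linarith [h1, h2]

/-! ### The one-point estimate -/

/-- **One-point estimate of the localised bootstrap.** Given the `L^∞` Duhamel bound (`hB`,
constant `C_B`, the tree's `exists_norm_oseenDuhamel_bounded_le` at `ν = 1`) and the far-part bound
(`hF`, constant `C₁`, `exists_norm_oseenDuhamel_far_le`): for `v ∈ A_C` with
`‖v(−36, y)‖ ≤ η` on `‖y‖ ≤ ρ`, a time `−36 < t ≤ −1`, a point `x` of the zone at time
`t` (`‖x‖ ≤ ρ − K√(t+36)`) and a bound `M` for `‖v‖` on the zone at the times `τ ∈ (−36, t)`,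
`‖v(t, x)‖ ≤ η + C·(2·2^{3/2})/K + 12 C_B M² + 12 C₁ C² (K/6)^{-1/2}`. [cite: KochNadirashviliSereginSverak2009, §4 p. 8 (arXiv:0709.3599)] -/
theorem one_point_estimate {CB C₁ : ℝ} (hCB : 0 ≤ CB) (hC₁ : 0 ≤ C₁)
    (hB : ∀ {u w : ℝ → EuclideanSpace ℝ (Fin 3) → EuclideanSpace ℝ (Fin 3)} {s t M : ℝ}, s < t →
      0 ≤ M → (∀ τ ∈ Ioo s t, ∀ y, ‖u τ y‖ ≤ M) → (∀ τ ∈ Ioo s t, ∀ y, ‖w τ y‖ ≤ M) →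
      ∀ x : EuclideanSpace ℝ (Fin 3),
        ‖oseenDuhamel 1 s u w t x‖ ≤ CB * M ^ 2 * (1 : ℝ) ^ (-(1 / 2 : ℝ)) * (2 * Real.sqrt (t - s)))
    (hF : ∀ {uf : ℝ → EuclideanSpace ℝ (Fin 3) → EuclideanSpace ℝ (Fin 3)} {s t N v : ℝ}
      (x : EuclideanSpace ℝ (Fin 3)), s < t → 0 ≤ N → 0 < v →
      (∀ τ ∈ Ioo s t, ∀ y, ‖uf τ y‖ ≤ N) →
      (∀ τ ∈ Ioo s t, ∀ y, ‖x - y‖ < v * (t - τ) → uf τ y = 0) →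
      ‖oseenDuhamel 1 s uf uf t x‖ ≤ C₁ * N ^ 2 * (2 * v) ^ (-(1 / 2 : ℝ)) * (4 * (t - s) ^ (1 / 4 : ℝ)))
    {C : ℝ} {v : ℝ → EuclideanSpace ℝ (Fin 3) → EuclideanSpace ℝ (Fin 3)} (hv : IsTypeIAncientMild C v)
    {K ρ η M t : ℝ} {x : EuclideanSpace ℝ (Fin 3)} (hK : 0 < K) (hη : 0 ≤ η)
    (hM : 0 ≤ M) (hdata : ∀ y : EuclideanSpace ℝ (Fin 3), ‖y‖ ≤ ρ → ‖v (-36) y‖ ≤ η)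
    (ht36 : -36 < t) (ht1 : t ≤ -1) (hx : ‖x‖ ≤ ρ - K * Real.sqrt (t + 36))
    (hzone : ∀ τ ∈ Ioo (-36) t, ∀ y : EuclideanSpace ℝ (Fin 3),
      ‖y‖ ≤ ρ - K * Real.sqrt (τ + 36) → ‖v τ y‖ ≤ M) :
    ‖v t x‖ ≤ η + C * (2 * (2 : ℝ) ^ ((Module.finrank ℝ (EuclideanSpace ℝ (Fin 3)) : ℝ) / 2)) / K +
      12 * CB * M ^ 2 + 12 * C₁ * C ^ 2 * (K / 6) ^ (-(1 / 2 : ℝ)) := by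
  set A₀ : ℝ := 2 * (2 : ℝ) ^ ((Module.finrank ℝ (EuclideanSpace ℝ (Fin 3)) : ℝ) / 2) with hA₀
  have hA₀0 : 0 ≤ A₀ := by positivity
  have hC : 0 ≤ C := hv.nonneg
  have ht0 : t < 0 := by linarith
  have hδ : 0 < t + 36 := by linarith
  have hs6 : Real.sqrt (t + 36) ≤ 6 := by
    rw [show (6 : ℝ) = Real.sqrt (6 ^ 2) by rw [Real.sqrt_sq (by norm_num)]]
    exact Real.sqrt_le_sqrt (by linarith)
  -- the zone as a space–time set
  set S : Set (ℝ × EuclideanSpace ℝ (Fin 3)) := {p | ‖p.2‖ ≤ ρ - K * Real.sqrt (p.1 + 36)} with hS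
  have hSc : IsClosed S :=
    isClosed_le (continuous_norm.comp continuous_snd)
      (continuous_const.sub (continuous_const.mul ((continuous_fst.add continuous_const).sqrt)))
  have hSm : MeasurableSet S := hSc.measurableSet
  -- global bound on the slab `(-36, t)`
  have h1le : 1 ≤ Real.sqrt (-t) := by
    rw [show (1 : ℝ) = Real.sqrt 1 by simp]
    exact Real.sqrt_le_sqrt (by linarith)
  have hN : ∀ τ ∈ Ioo (-36 : ℝ) t, ∀ y, ‖v τ y‖ ≤ C := fun τ hτ y =>
    (hv.norm_le_of_mem_Ioo ht0 hτ y).trans (div_le_self hC h1le)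
  have hN36 : ∀ z, ‖v (-36) z‖ ≤ C := fun z => by
    refine (hv.norm_le (by norm_num) z).trans (div_le_self hC ?_)
    rw [show (1 : ℝ) = Real.sqrt 1 by simp]
    exact Real.sqrt_le_sqrt (by norm_num)
  -- continuity on a slab containing `(-36, t)`
  have hcont : ContinuousOn (uncurry v) (Ioo (-37 : ℝ) 0 ×ˢ univ) :=
    hv.continuousOn_uncurry.mono (prod_mono (fun τ hτ => hτ.2) subset_rfl)
  -- (1) the caloric term
  have hheat : ‖heatExtension (v (-36)) (t - -36) x‖ ≤ η + C * A₀ / K := by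
    have hxρ : ‖x - 0‖ < ρ := by
      rw [sub_zero]
      have : 0 < K * Real.sqrt (t + 36) := mul_pos hK (Real.sqrt_pos.2 hδ)
      linarith
    have h := norm_heatExtension_le_of_small_on_ball (hv.continuous_slice (by norm_num)) (x₀ := 0)
      hN36 hη (fun z hz => hdata z (by simpa using hz)) hxρ (by linarith : (0 : ℝ) < t - -36)
    rw [sub_zero] at h
    refine h.trans (add_le_add le_rfl ?_)
    -- `C * (A₀ * (t+36)^{1/2}) / (ρ - ‖x‖) ≤ C * A₀ / K`
    have hr : K * Real.sqrt (t + 36) ≤ ρ - ‖x‖ := by linarith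
    have hrpos : 0 < ρ - ‖x‖ := lt_of_lt_of_le (mul_pos hK (Real.sqrt_pos.2 hδ)) hr
    have hsq : (t - -36) ^ (1 / 2 : ℝ) = Real.sqrt (t + 36) := by
      rw [Real.sqrt_eq_rpow]; ring_nf
    rw [hsq, div_le_div_iff₀ hrpos hK]
    calc C * (A₀ * Real.sqrt (t + 36)) * K = C * A₀ * (K * Real.sqrt (t + 36)) := by ring
      _ ≤ C * A₀ * (ρ - ‖x‖) := mul_le_mul_of_nonneg_left hr (by positivity)
  -- (2) the near part
  set vn : ℝ → EuclideanSpace ℝ (Fin 3) → EuclideanSpace ℝ (Fin 3) :=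
    fun τ y => S.indicator (uncurry v) (τ, y) with hvn
  have hvn_bd : ∀ τ ∈ Ioo (-36 : ℝ) t, ∀ y, ‖vn τ y‖ ≤ M := by
    intro τ hτ y
    simp only [hvn]
    by_cases hp : (τ, y) ∈ S
    · rw [indicator_of_mem hp]; exact hzone τ hτ y hp
    · rw [indicator_of_notMem hp, norm_zero]; exact hM
  have hnear : ‖oseenDuhamel 1 (-36) vn vn t x‖ ≤ 12 * CB * M ^ 2 := by
    refine (hB ht36 hM hvn_bd hvn_bd x).trans ?_
    rw [Real.one_rpow, mul_one, show t - -36 = t + 36 by ring]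
    calc CB * M ^ 2 * (2 * Real.sqrt (t + 36)) ≤ CB * M ^ 2 * (2 * 6) := by gcongr
      _ = 12 * CB * M ^ 2 := by ring
  -- (3) the far part
  set vf : ℝ → EuclideanSpace ℝ (Fin 3) → EuclideanSpace ℝ (Fin 3) :=
    fun τ y => Sᶜ.indicator (uncurry v) (τ, y) with hvf
  have hvf_bd : ∀ τ ∈ Ioo (-36 : ℝ) t, ∀ y, ‖vf τ y‖ ≤ C := by
    intro τ hτ y
    simp only [hvf]
    by_cases hp : (τ, y) ∈ Sᶜ
    · rw [indicator_of_mem hp]; exact hN τ hτ y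
    · rw [indicator_of_notMem hp, norm_zero]; exact hC
  have hvf_far : ∀ τ ∈ Ioo (-36 : ℝ) t, ∀ y, ‖x - y‖ < K / 12 * (t - τ) → vf τ y = 0 := by
    intro τ hτ y hxy
    have hgap := zone_gap hK.le hτ.1.le hτ.2.le ht1
    have hyS : (τ, y) ∈ S := by
      show ‖y‖ ≤ ρ - K * Real.sqrt (τ + 36)
      calc ‖y‖ = ‖x - (x - y)‖ := by rw [sub_sub_cancel]
        _ ≤ ‖x‖ + ‖x - y‖ := norm_sub_le _ _
        _ ≤ ρ - K * Real.sqrt (τ + 36) := by linarith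
    simp only [hvf]
    exact indicator_of_notMem (show (τ, y) ∉ Sᶜ from fun h => h hyS) _
  have hfar : ‖oseenDuhamel 1 (-36) vf vf t x‖ ≤ 12 * C₁ * C ^ 2 * (K / 6) ^ (-(1 / 2 : ℝ)) := by
    refine (hF x ht36 hC (by positivity : (0 : ℝ) < K / 12) hvf_bd hvf_far).trans ?_
    rw [show 2 * (K / 12) = K / 6 by ring, show t - -36 = t + 36 by ring]
    have h3 := rpow_quarter_le_three ht36 ht1
    have hnn : 0 ≤ C₁ * C ^ 2 * (K / 6) ^ (-(1 / 2 : ℝ)) := by positivity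
    calc C₁ * C ^ 2 * (K / 6) ^ (-(1 / 2 : ℝ)) * (4 * (t + 36) ^ (1 / 4 : ℝ))
        ≤ C₁ * C ^ 2 * (K / 6) ^ (-(1 / 2 : ℝ)) * (4 * 3) := by gcongr
      _ = 12 * C₁ * C ^ 2 * (K / 6) ^ (-(1 / 2 : ℝ)) := by ring
  -- assemble
  have hmild := hv.mild_eq_heatExtension ht36 ht0 x
  have hsplit := oseenDuhamel_eq_add_of_indicator_compl_spaceTime one_pos hcont
    (by norm_num : (-37 : ℝ) ≤ -36) ht0.le ht36 hC hN hSm x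
  rw [hmild, hsplit]
  calc ‖heatExtension (v (-36)) (t - -36) x - (oseenDuhamel 1 (-36) vn vn t x + oseenDuhamel 1 (-36) vf vf t x)‖
      ≤ ‖heatExtension (v (-36)) (t - -36) x‖ +
          (‖oseenDuhamel 1 (-36) vn vn t x‖ + ‖oseenDuhamel 1 (-36) vf vf t x‖) :=
        (norm_sub_le _ _).trans (add_le_add le_rfl (norm_add_le _ _))
    _ ≤ (η + C * A₀ / K) + (12 * CB * M ^ 2 + 12 * C₁ * C ^ 2 * (K / 6) ^ (-(1 / 2 : ℝ))) :=
        add_le_add hheat (add_le_add hnear hfar)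
    _ = _ := by ring

end Summit.NavierStokesRegularity.NavierStokesRegularity.Theorems.ScrewSymmetricLiouville

end
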